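import Summits.QuantumFields.Balaban3D.Proofs.FibreFormula

/-!
# `Summit.QuantumFields.Balaban3D.Proofs.AxialFibre` — the FIBRE PARAMETRISATION of the lane's axial averaging
# (LQB `AveragingRT.axialAvg` = `stdAvg` in the standing range, seat p1's `ExternalInputs.ofStd`): `Φ(V, W) := W` with the LAST
# bond variable of every line multiplied by `(W̄(c))⁻¹V(c)`, so that `Φ(V, W)‾ = V`, `Φ_*(dV ⊗ dW) = dU`; hence
# `(Tρ)(V) = ∫ ρ(Φ(V, W)) dW` dV-a.e. for the lane's renormalization transform — [Balaban1985UV3] (10) p. 258 «∫dU δ(ŪV^{−1}) …»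
# as an honest finite-dimensional Haar integral, pointwise in `V` — lane `pub-balaban3d`, seat p4 (tool for the (β) residuals of
# `…Proofs.Bound55Tower`)

HONEST FRAMING (lane PLAN.md §0, binding): see `…Proofs.SectAFirstStep`.  [folklore] measure theory over LQB's axial-average
combinatorics (`AveragingRT.axialAvg_mul_last`, `last_injective`, `line_ne_last`) and Weil uniqueness
(`AveragingRT.measure_eq_mass_smul_of_invariant`); nothing of the paper is asserted.  This is NOT print's weighted average Ū of [4]
(15) (binder b7, F-p1-2); it is the averaging the lane's standard external inputs use.

WHAT THIS FILE PROVES (no `sorry`, axioms standard), in the standing range `j + 1 ≤ m + K`: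
* `lastExt` (extension of a coarse-bond function to the last bonds of the lines, `1` elsewhere) with `lastExt_last`,
  `lastExt_of_not_last`; `axialParam V W` (the parametrisation) with **`axialAvg_axialParam : (axialParam V W)‾ = V`**;
  `skewMap`/`axialParam_mul` (right translations of the fine field pulled back through `Φ`);
* `measurable_axialParam`; **`map_axialParam : (dV ⊗ dW).map Φ = dU`** (the push-forward is a right-invariant probability on the
  fine fields — right translation by `k′` is undone by the measure-preserving skew change of variables `(V, W) ↦ (a(W)·V·k′_last,
  W·k′)` — hence product Haar by Weil uniqueness against the left-invariant `dU`);
* **`isFibreParam_axial`** — `FibreFormula.IsFibreParam dW axialParam` for `Ū = axialAvg`; so `FibreFormula.rnTransport_ae_eq_fibreIntegral`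
  gives `(Tρ)(V) = ∫ ρ(axialParam V W) dW` dV-a.e. (`rnTransport_axial_ae_eq`).
-/

noncomputable section

namespace Summit.QuantumFields.Balaban3D.Proofs.AxialFibre

open _root_.MeasureTheory
open Literature.MathematicalPhysics.QuantumFieldTheory.Balaban1983to89
open Literature.MathematicalPhysics.QuantumFieldTheory.Balaban1983to89.AveragingRT
open Summit.QuantumFields.Balaban3D.Proofs.FibreFormula

variable {P : Params} {j : ℕ} {G : Type*} [GaugeGroup G]

/-! ## §1 The parametrisation and its algebra -/

/-- Extension of a function of the coarse bonds to the fine bonds: `g(c)` on the LAST bond `line c (L−1)` of the line of `c`,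
`1` elsewhere (LQB's device in `axialAvg_mul_last`). [folklore] -/
def lastExt (g : PBond P (j + 1) → G) : PBond P j → G :=
  Function.extend (fun c : PBond P (j + 1) => line c (P.L - 1)) g fun _ => 1

/-- On the last bond of the line of `c`, `lastExt g = g c` (standing range: `last_injective`). [folklore] -/
theorem lastExt_last (hj : j + 1 ≤ P.m + P.K) (g : PBond P (j + 1) → G) (c : PBond P (j + 1)) :
    lastExt g (line c (P.L - 1)) = g c :=
  (last_injective hj).extend_apply g (fun _ => (1 : G)) c

/-- Off the last bonds, `lastExt g = 1`. [folklore] -/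
theorem lastExt_of_not_last (g : PBond P (j + 1) → G) {b : PBond P j}
    (hb : ¬ ∃ c : PBond P (j + 1), line c (P.L - 1) = b) : lastExt g b = 1 :=
  Function.extend_apply' g (fun _ => (1 : G)) b hb

/-- **THE FIBRE PARAMETRISATION of the axial average**: `Φ(V, W)(b) = W(b)` except on the last bond of each line, where
`Φ(V, W)(line c (L−1)) = W(line c (L−1))·(W̄(c))⁻¹·V(c)`. [folklore] -/
def axialParam (V : GaugeField P (j + 1) G) (W : GaugeField P j G) : GaugeField P j G :=
  fun b => W b * lastExt (fun c => (axialAvg W c)⁻¹ * V c) b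

/-- **`Φ(V, W)` lies in the fibre of `V`**: `(axialParam V W)‾ = V` (LQB `axialAvg_mul_last`). [folklore] -/
theorem axialAvg_axialParam (hj : j + 1 ≤ P.m + P.K) (V : GaugeField P (j + 1) G) (W : GaugeField P j G) :
    axialAvg (axialParam V W) = V := by
  have h := axialAvg_mul_last hj W (fun c => (axialAvg W c)⁻¹ * V c)
  unfold axialParam lastExt
  rw [h]
  funext c
  rw [mul_inv_cancel_left]

/-- The change of variables undoing a right translation by `k′` of the fine field: `(V, W) ↦ (a(W)·V·k′_last, W·k′)` with
`a_c(W) = (W·k′)‾(c)·(k′(line c (L−1)))⁻¹·(W̄(c))⁻¹`. [folklore] -/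
def skewMap (k' : PBond P j → G) (p : GaugeField P (j + 1) G × GaugeField P j G) :
    GaugeField P (j + 1) G × GaugeField P j G :=
  (fun c => axialAvg (fun b => p.2 b * k' b) c * (k' (line c (P.L - 1)))⁻¹ * (axialAvg p.2 c)⁻¹ * p.1 c
      * k' (line c (P.L - 1)),
    fun b => p.2 b * k' b)

/-- Right translation of the fine field commutes past the parametrisation up to `skewMap`:
`Φ(V, W)·k′ = Φ(skewMap k′ (V, W))`. [folklore] -/
theorem axialParam_mul (hj : j + 1 ≤ P.m + P.K) (k' : PBond P j → G) (p : GaugeField P (j + 1) G × GaugeField P j G) :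
    (fun b => axialParam p.1 p.2 b * k' b) = axialParam (skewMap k' p).1 (skewMap k' p).2 := by
  funext b
  unfold axialParam skewMap
  by_cases hb : ∃ c : PBond P (j + 1), line c (P.L - 1) = b
  · obtain ⟨c, rfl⟩ := hb
    rw [lastExt_last hj, lastExt_last hj]
    group
  · rw [lastExt_of_not_last _ hb, lastExt_of_not_last _ hb, mul_one, mul_one]

/-! ## §2 Measurability and the push-forward `Φ_*(dV ⊗ dW) = dU` -/

variable [MeasurableSpace G] [HaarData G] [MeasurableMul₂ G] [MeasurableInv G]

omit [HaarData G] in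
/-- Each coordinate of `Φ` is a measurable function of `(V, W)`. [folklore] -/
theorem measurable_axialParam (hj : j + 1 ≤ P.m + P.K) :
    Measurable fun p : GaugeField P (j + 1) G × GaugeField P j G => axialParam p.1 p.2 := by
  refine measurable_pi_iff.mpr fun b => ?_
  by_cases hb : ∃ c : PBond P (j + 1), line c (P.L - 1) = b
  · obtain ⟨c, rfl⟩ := hb
    have h : (fun p : GaugeField P (j + 1) G × GaugeField P j G => axialParam p.1 p.2 (line c (P.L - 1)))
        = fun p => p.2 (line c (P.L - 1)) * ((axialAvg p.2 c)⁻¹ * p.1 c) := by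
      funext p; unfold axialParam; rw [lastExt_last hj]
    rw [h]
    refine ((measurable_pi_apply _).comp measurable_snd).mul ?_
    exact (((measurable_pi_apply c).comp (measurable_axialAvg.comp measurable_snd)).inv).mul
      ((measurable_pi_apply c).comp measurable_fst)
  · have h : (fun p : GaugeField P (j + 1) G × GaugeField P j G => axialParam p.1 p.2 b) = fun p => p.2 b := by
      funext p; unfold axialParam; rw [lastExt_of_not_last _ hb, mul_one]
    rw [h]
    exact (measurable_pi_apply _).comp measurable_snd

/-- The change of variables `skewMap k′` preserves `dV ⊗ dW` (a skew product over the measure-preserving `W ↦ W·k′`, each fibre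
map a two-sided translation of `dV`). [folklore] -/
theorem measurePreserving_skew (k' : PBond P j → G) :
    MeasurePreserving (skewMap (P := P) (G := G) (j := j) k')
      ((fieldMeasure P (j + 1) G).prod (fieldMeasure P j G)) ((fieldMeasure P (j + 1) G).prod (fieldMeasure P j G)) := by
  -- the coefficient field `a(W)` and the fibre map `g W V`
  let a : GaugeField P j G → GaugeField P (j + 1) G :=
    fun W c => axialAvg (fun b => W b * k' b) c * (k' (line c (P.L - 1)))⁻¹ * (axialAvg W c)⁻¹
  have ha_meas : Measurable a := by
    refine measurable_pi_iff.mpr fun c => ?_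
    have h1 : Measurable fun W : GaugeField P j G => axialAvg (fun b => W b * k' b) c :=
      (measurable_pi_apply c).comp (measurable_axialAvg.comp (measurePreserving_mulRight k').measurable)
    have h2 : Measurable fun W : GaugeField P j G => (axialAvg W c)⁻¹ :=
      ((measurable_pi_apply c).comp measurable_axialAvg).inv
    exact (h1.mul measurable_const).mul h2
  let g : GaugeField P j G → GaugeField P (j + 1) G → GaugeField P (j + 1) G :=
    fun W V c => a W c * V c * k' (line c (P.L - 1))
  have hg_meas : Measurable (Function.uncurry g) := by
    refine measurable_pi_iff.mpr fun c => ?_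
    exact ((((measurable_pi_apply c).comp (ha_meas.comp measurable_fst)).mul
      ((measurable_pi_apply c).comp measurable_snd)).mul measurable_const)
  have hg_pres : ∀ W, Measure.map (g W) (fieldMeasure P (j + 1) G) = fieldMeasure P (j + 1) G := fun W => by
    have hcomp : g W = (fun (V : GaugeField P (j + 1) G) (c : PBond P (j + 1)) => V c * k' (line c (P.L - 1))) ∘
        (fun (V : GaugeField P (j + 1) G) (c : PBond P (j + 1)) => a W c * V c) := by
      funext V c; rfl
    rw [hcomp]
    exact ((measurePreserving_mulRight (P := P) (j := j + 1) fun c => k' (line c (P.L - 1))).comp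
      (measurePreserving_mulLeft (a W))).map_eq
  let R : GaugeField P j G → GaugeField P j G := fun W b => W b * k' b
  have hRW : MeasurePreserving R (fieldMeasure P j G) (fieldMeasure P j G) := measurePreserving_mulRight k'
  -- skew product over the FIRST factor after swapping
  have hswap₁ : MeasurePreserving (Prod.swap : GaugeField P (j + 1) G × GaugeField P j G → GaugeField P j G × GaugeField P (j + 1) G)
      ((fieldMeasure P (j + 1) G).prod (fieldMeasure P j G)) ((fieldMeasure P j G).prod (fieldMeasure P (j + 1) G)) :=
    Measure.measurePreserving_swap
  have hswap₂ : MeasurePreserving (Prod.swap : GaugeField P j G × GaugeField P (j + 1) G → GaugeField P (j + 1) G × GaugeField P j G)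
      ((fieldMeasure P j G).prod (fieldMeasure P (j + 1) G)) ((fieldMeasure P (j + 1) G).prod (fieldMeasure P j G)) :=
    Measure.measurePreserving_swap
  have hskew : MeasurePreserving (fun p : GaugeField P j G × GaugeField P (j + 1) G => (R p.1, g p.1 p.2))
      ((fieldMeasure P j G).prod (fieldMeasure P (j + 1) G)) ((fieldMeasure P j G).prod (fieldMeasure P (j + 1) G)) :=
    hRW.skew_product hg_meas (Filter.Eventually.of_forall hg_pres)
  have hcomp := hswap₂.comp (hskew.comp hswap₁)
  have hfun : skewMap (P := P) (G := G) (j := j) k'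
      = Prod.swap ∘ ((fun p : GaugeField P j G × GaugeField P (j + 1) G => (R p.1, g p.1 p.2)) ∘ Prod.swap) := by
    funext p; rfl
  rw [hfun]
  exact hcomp

/-- **`Φ_*(dV ⊗ dW) = dU`**: the push-forward of the product measure under the parametrisation is product Haar on the fine fields
— a right-invariant probability (right translations are undone by `measurePreserving_skew`, `axialParam_mul`), hence equal to the
left-invariant probability `dU` by Weil uniqueness (`AveragingRT.measure_eq_mass_smul_of_invariant`). [folklore] -/
theorem map_axialParam (hj : j + 1 ≤ P.m + P.K) :
    ((fieldMeasure P (j + 1) G).prod (fieldMeasure P j G)).map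
        (fun p : GaugeField P (j + 1) G × GaugeField P j G => axialParam p.1 p.2) = fieldMeasure P j G := by
  letI : Group (GaugeField P j G) := Pi.group
  letI : MeasurableMul₂ (GaugeField P j G) := Pi.measurableMul₂
  have hΦ := measurable_axialParam (P := P) (G := G) hj
  set μ' := ((fieldMeasure P (j + 1) G).prod (fieldMeasure P j G)).map
    (fun p : GaugeField P (j + 1) G × GaugeField P j G => axialParam p.1 p.2) with hμ'
  haveI : IsProbabilityMeasure μ' := Measure.isProbabilityMeasure_map hΦ.aemeasurable
  have h := measure_eq_mass_smul_of_invariant (fieldMeasure P j G) μ' ?_ ?_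
  · rw [h, measure_univ, one_smul]
  · intro k
    exact (measurePreserving_mulLeft (P := P) (j := j) k).map_eq
  · intro k'
    have hR : Measurable (fun x : GaugeField P j G => x * k') := measurable_mul_const k'
    have hΨ := measurePreserving_skew (P := P) (G := G) (j := j) k'
    have hcomp : (fun x : GaugeField P j G => x * k') ∘ (fun p : GaugeField P (j + 1) G × GaugeField P j G => axialParam p.1 p.2)
        = (fun p : GaugeField P (j + 1) G × GaugeField P j G => axialParam p.1 p.2) ∘ skewMap k' := by
      funext p
      exact axialParam_mul hj k' p
    rw [Measure.map_map hR hΦ, hcomp, ← Measure.map_map hΦ hΨ.measurable, hΨ.map_eq]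

/-- **The axial average admits the fibre parametrisation `axialParam`** (`FibreFormula.IsFibreParam` with fibre law `dW` = product
Haar on the fine fields). [folklore] -/
theorem isFibreParam_axial (hj : j + 1 ≤ P.m + P.K) :
    IsFibreParam (fieldMeasure P j G) (fun p : GaugeField P (j + 1) G × GaugeField P j G => axialParam p.1 p.2)
      (avg := (axialAvg : GaugeField P j G → GaugeField P (j + 1) G)) where
  measurable_avg := measurable_axialAvg
  measurable := measurable_axialParam hj
  map_eq := map_axialParam hj
  avg_apply := fun V W => axialAvg_axialParam hj V W

/-- **THE FIBRE INTEGRAL OF THE LANE'S TRANSFORM** ([Balaban1985UV3] (10) p. 258 / [Balaban1985Averaging] (10) p. 19 «(Tρ)(V) =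
∫dU δ(ŪV^{−1})ρ(U)» made an honest integral): for the axial average and every integrable density,
`rnTransport Ū ρ (V) = ∫ ρ(axialParam V W) dW` for dV-a.e. `V`. [cite: Balaban1985UV3, (10) p.258] -/
theorem rnTransport_axial_ae_eq (hj : j + 1 ≤ P.m + P.K) (ρ : Density P j G) (hρ : Integrable ρ (fieldMeasure P j G)) :
    rnTransport (axialAvg : GaugeField P j G → GaugeField P (j + 1) G) ρ
      =ᵐ[fieldMeasure P (j + 1) G] fun V => ∫ W, ρ (axialParam V W) ∂(fieldMeasure P j G) :=
  rnTransport_ae_eq_fibreIntegral (isFibreParam_axial hj) ρ hρ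

end Summit.QuantumFields.Balaban3D.Proofs.AxialFibre

end
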